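import Summits.ValiantsHypothesis.ValiantsHypothesis.Theorems.GrenetZeonDualUnipotentThreeHalvesLongMassNilSpaceViolatorPortrait
import Summits.ValiantsHypothesis.ValiantsHypothesis.Theorems.GrenetZeonDualUnipotentThreeHalvesLongMassNilSpaceTraceCriterion
import Summits.ValiantsHypothesis.ValiantsHypothesis.Theorems.GrenetZeonDualUnipotentThreeHalvesLongMassTriangularTwo

/-!
# `GrenetZeon.DualUnipotentThreeHalves` (stmt-ValiantsHypothesis-24318), line `slow_core`, stub (c) `SlowCore.LongMassSlowLawInv`:
# THE VIOLATOR PORTRAIT, SHARPENED — wildness from budget `2·⌊√n⌋·b`, with the TRACE line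

Addendum to ✓ `…LongMassNilSpaceViolatorPortrait` using ✓ `…LongMassTriangularTwo` (the triangularisable row at `c = 2`) and ✓
`…LongMassNilSpaceTraceCriterion` (triangularisable ⟺ all words traceless):

* `price_triangularisable_submodule_two` — submodule currency: one unit conjugating `V` (`dim V ≤ n²`) into the strictly upper triangular
  matrices ⇒ a certificate of price `≤ 2·(⌊√n⌋·b)` (per-space bridge ✓ `price_submodule_of_relCert_linear`).
* ★ `not_triangularisable_of_expensive_two`, `exists_word_ne_zero_of_expensive_two`, `exists_trace_word_ne_zero_of_expensive_two`,
  `not_lieClosed_of_expensive_two` — an EXPENSIVE space at budget `P ≥ 2·⌊√n⌋·b` (`dim V ≤ n²`) is not triangularisable, has a non-vanishing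
  word of length `b`, has a word of positive length with NON-ZERO TRACE, and (if nil) is not Lie-closed.
* ★★ `violator_portrait_two` — the conjunction at the (c)-budget `c·(⌊√n⌋·b)` for every `c ≥ 2` (MASS, SIZE, LENGTH, RANK, WILDNESS incl. the
  trace line).  Since (c) fails at `c = 1` (✓ `not_longMassSlowLawAll_one`), `c ≥ 2` is the whole range of interest.

HONEST FRAMING.  Checklist (`--supports stmt-ValiantsHypothesis-24318`); NOT progress on the research stub (c) `SlowCore.LongMassSlowLawInv`; closes no
stub; S3, 24318, 8062 and `VP ≠ VNP` are NOT proved.  Def-free, no named-fact hypotheses, no sorry.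
[cite: Meshulam1985, Thm. 2 (p. 226)] [cite: deSeguinsPazzis2013Gerstenhaber, Theorem 1] [cite: HornJohnson2013, 2.4.P10 (p0171)]
-/

set_option linter.dupNamespace false
set_option autoImplicit false

noncomputable section

namespace Summit.ValiantsHypothesis.ValiantsHypothesis.Theorems.GrenetZeon.NilSpaceViolatorPortrait

open MvPolynomial Matrix
open scoped BigOperators
open Summit.ValiantsHypothesis.ValiantsHypothesis.Theorems.GrenetZeon.NilSpaceRankCeiling (exists_rank_gt_sqrt_of_expensive)
open Summit.ValiantsHypothesis.ValiantsHypothesis.Theorems.GrenetZeon.NilSpaceEngel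
  (price_submodule_of_relCert_linear words_eq_zero_of_conj_strictUpper conj_strictUpper_iff_trace_words_eq_zero
    exists_unit_conj_strictUpper_of_lieClosed exists_unit_conj_strictUpper_of_words_eq_zero)
open Summit.ValiantsHypothesis.ValiantsHypothesis.Theorems.GrenetZeon.TriangularRow (relCert_of_valueSpace_triangularisable_two)

variable {b : ℕ}

/-! ## §1 The triangularisable ceiling at `c = 2`, submodule currency -/

/-- **Triangularisable row at `c = 2`, submodule currency.** -/
theorem price_triangularisable_submodule_two (V : Submodule ℂ (Matrix (Fin b) (Fin b) ℂ)) {n : ℕ} (hV : Module.finrank ℂ V ≤ n * n)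
    (P : (Matrix (Fin b) (Fin b) ℂ)ˣ)
    (hP : ∀ A ∈ V, ∀ i j : Fin b, j ≤ i → ((P : Matrix (Fin b) (Fin b) ℂ) * A * (↑P⁻¹ : Matrix (Fin b) (Fin b) ℂ)) i j = 0) :
    ∃ (W : Submodule ℂ (Matrix (Fin b) (Fin b) ℂ)) (k : ℕ), W ≤ V ∧
      (∀ A ∈ V, ∀ w ∈ W, ∀ p : ℕ, p ≤ n - 1 → ∀ i j : Fin b,
        ((((A.map (C : ℂ → MvPolynomial (Fin 1) ℂ) + (X 0 : MvPolynomial (Fin 1) ℂ) • w.map C) ^ p :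
          Matrix (Fin b) (Fin b) (MvPolynomial (Fin 1) ℂ)) i j).totalDegree ≤ k)) ∧
      n * k + (Module.finrank ℂ V - Module.finrank ℂ W) ≤ 2 * (Nat.sqrt n * b) :=
  price_submodule_of_relCert_linear V hV _ fun N₁ haff _ hvals =>
    relCert_of_valueSpace_triangularisable_two N₁ haff V hvals P hP

/-! ## §2 Wildness from budget `2·⌊√n⌋·b` -/

/-- ★ **Not triangularisable** (budget `≥ 2⌊√n⌋b`, `dim V ≤ n²`). -/
theorem not_triangularisable_of_expensive_two (V : Submodule ℂ (Matrix (Fin b) (Fin b) ℂ)) (n P : ℕ) (hV : Module.finrank ℂ V ≤ n * n)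
    (hP : 2 * (Nat.sqrt n * b) ≤ P)
    (hexp : ∀ (W : Submodule ℂ (Matrix (Fin b) (Fin b) ℂ)) (k : ℕ), W ≤ V →
      (∀ A ∈ V, ∀ w ∈ W, ∀ p : ℕ, p ≤ n - 1 → ∀ i j : Fin b,
        ((((A.map (C : ℂ → MvPolynomial (Fin 1) ℂ) + (X 0 : MvPolynomial (Fin 1) ℂ) • w.map C) ^ p :
          Matrix (Fin b) (Fin b) (MvPolynomial (Fin 1) ℂ)) i j).totalDegree ≤ k)) →
      P < n * k + (Module.finrank ℂ V - Module.finrank ℂ W)) :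
    ¬ ∃ Q : (Matrix (Fin b) (Fin b) ℂ)ˣ, ∀ A ∈ V, ∀ i j : Fin b, j ≤ i →
      ((Q : Matrix (Fin b) (Fin b) ℂ) * A * (↑Q⁻¹ : Matrix (Fin b) (Fin b) ℂ)) i j = 0 := by
  rintro ⟨Q, hQ⟩
  obtain ⟨W, k, hW, hwin, hprice⟩ := price_triangularisable_submodule_two V hV Q hQ
  have := hexp W k hW hwin
  omega

/-- ★ **A non-vanishing word of length `b`** (budget `≥ 2⌊√n⌋b`). -/
theorem exists_word_ne_zero_of_expensive_two (V : Submodule ℂ (Matrix (Fin b) (Fin b) ℂ)) (n P : ℕ) (hV : Module.finrank ℂ V ≤ n * n)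
    (hP : 2 * (Nat.sqrt n * b) ≤ P)
    (hexp : ∀ (W : Submodule ℂ (Matrix (Fin b) (Fin b) ℂ)) (k : ℕ), W ≤ V →
      (∀ A ∈ V, ∀ w ∈ W, ∀ p : ℕ, p ≤ n - 1 → ∀ i j : Fin b,
        ((((A.map (C : ℂ → MvPolynomial (Fin 1) ℂ) + (X 0 : MvPolynomial (Fin 1) ℂ) • w.map C) ^ p :
          Matrix (Fin b) (Fin b) (MvPolynomial (Fin 1) ℂ)) i j).totalDegree ≤ k)) →
      P < n * k + (Module.finrank ℂ V - Module.finrank ℂ W)) :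
    ∃ w : Fin b → Matrix (Fin b) (Fin b) ℂ, (∀ t, w t ∈ V) ∧ (List.ofFn w).prod ≠ 0 := by
  by_contra hcon
  push Not at hcon
  exact not_triangularisable_of_expensive_two V n P hV hP hexp
    (exists_unit_conj_strictUpper_of_words_eq_zero V (s := b) fun w hw => hcon w hw)

/-- ★ **THE TRACE LINE**: a word of positive length with NON-ZERO TRACE (budget `≥ 2⌊√n⌋b`). [cite: HornJohnson2013, 2.4.P10 (p0171)] -/
theorem exists_trace_word_ne_zero_of_expensive_two (V : Submodule ℂ (Matrix (Fin b) (Fin b) ℂ)) (n P : ℕ)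
    (hV : Module.finrank ℂ V ≤ n * n) (hP : 2 * (Nat.sqrt n * b) ≤ P)
    (hexp : ∀ (W : Submodule ℂ (Matrix (Fin b) (Fin b) ℂ)) (k : ℕ), W ≤ V →
      (∀ A ∈ V, ∀ w ∈ W, ∀ p : ℕ, p ≤ n - 1 → ∀ i j : Fin b,
        ((((A.map (C : ℂ → MvPolynomial (Fin 1) ℂ) + (X 0 : MvPolynomial (Fin 1) ℂ) • w.map C) ^ p :
          Matrix (Fin b) (Fin b) (MvPolynomial (Fin 1) ℂ)) i j).totalDegree ≤ k)) →
      P < n * k + (Module.finrank ℂ V - Module.finrank ℂ W)) :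
    ∃ (s : ℕ) (w : Fin (s + 1) → Matrix (Fin b) (Fin b) ℂ), (∀ t, w t ∈ V) ∧ ((List.ofFn w).prod).trace ≠ 0 := by
  by_contra hcon
  push Not at hcon
  exact not_triangularisable_of_expensive_two V n P hV hP hexp
    ((conj_strictUpper_iff_trace_words_eq_zero V).mpr fun s w hw => hcon s w hw)

/-- ★ **Not Lie-closed** (nil `V`, budget `≥ 2⌊√n⌋b`). -/
theorem not_lieClosed_of_expensive_two (V : Submodule ℂ (Matrix (Fin b) (Fin b) ℂ)) (hnil : ∀ A ∈ V, IsNilpotent A) (n P : ℕ)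
    (hV : Module.finrank ℂ V ≤ n * n) (hP : 2 * (Nat.sqrt n * b) ≤ P)
    (hexp : ∀ (W : Submodule ℂ (Matrix (Fin b) (Fin b) ℂ)) (k : ℕ), W ≤ V →
      (∀ A ∈ V, ∀ w ∈ W, ∀ p : ℕ, p ≤ n - 1 → ∀ i j : Fin b,
        ((((A.map (C : ℂ → MvPolynomial (Fin 1) ℂ) + (X 0 : MvPolynomial (Fin 1) ℂ) • w.map C) ^ p :
          Matrix (Fin b) (Fin b) (MvPolynomial (Fin 1) ℂ)) i j).totalDegree ≤ k)) →
      P < n * k + (Module.finrank ℂ V - Module.finrank ℂ W)) :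
    ∃ A ∈ V, ∃ B ∈ V, A * B - B * A ∉ V := by
  by_contra hcon
  push Not at hcon
  exact not_triangularisable_of_expensive_two V n P hV hP hexp (exists_unit_conj_strictUpper_of_lieClosed V hnil hcon)

/-! ## §3 The sharpened portrait -/

/-- ★★ **THE VIOLATOR PORTRAIT at the (c)-budget `c·(⌊√n⌋·b)`, every `c ≥ 2`.**  A nilpotent `V ≤ M_b(ℂ)` with `dim V ≤ n²` and no certificate
of price `≤ c⌊√n⌋b` has: MASS `dim V > c⌊√n⌋b`; SIZE `c⌊√n⌋b < C(b,2)`; LENGTH a member with `A^H ≠ 0` whenever `1 ≤ H`, `n(H−1) ≤ c⌊√n⌋b`;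
RANK a member of rank `> c⌊√n⌋`; WILDNESS a non-vanishing word of length `b`, a word with non-zero trace, a commutator leaving `V`.
[cite: Meshulam1985, Thm. 2 (p. 226)] [cite: deSeguinsPazzis2013Gerstenhaber, Theorem 1] [cite: HornJohnson2013, 2.4.P10 (p0171)] -/
theorem violator_portrait_two (V : Submodule ℂ (Matrix (Fin b) (Fin b) ℂ)) (hnil : ∀ A ∈ V, IsNilpotent A) (n c : ℕ)
    (hV : Module.finrank ℂ V ≤ n * n) (hc : 2 ≤ c)
    (hexp : ∀ (W : Submodule ℂ (Matrix (Fin b) (Fin b) ℂ)) (k : ℕ), W ≤ V →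
      (∀ A ∈ V, ∀ w ∈ W, ∀ p : ℕ, p ≤ n - 1 → ∀ i j : Fin b,
        ((((A.map (C : ℂ → MvPolynomial (Fin 1) ℂ) + (X 0 : MvPolynomial (Fin 1) ℂ) • w.map C) ^ p :
          Matrix (Fin b) (Fin b) (MvPolynomial (Fin 1) ℂ)) i j).totalDegree ≤ k)) →
      c * (Nat.sqrt n * b) < n * k + (Module.finrank ℂ V - Module.finrank ℂ W)) :
    c * (Nat.sqrt n * b) < Module.finrank ℂ V ∧
      c * (Nat.sqrt n * b) < b.choose 2 ∧
      (∀ H : ℕ, 1 ≤ H → n * (H - 1) ≤ c * (Nat.sqrt n * b) → ∃ A ∈ V, A ^ H ≠ 0) ∧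
      (∃ A ∈ V, c * Nat.sqrt n < A.rank) ∧
      (∃ w : Fin b → Matrix (Fin b) (Fin b) ℂ, (∀ t, w t ∈ V) ∧ (List.ofFn w).prod ≠ 0) ∧
      (∃ (s : ℕ) (w : Fin (s + 1) → Matrix (Fin b) (Fin b) ℂ), (∀ t, w t ∈ V) ∧ ((List.ofFn w).prod).trace ≠ 0) ∧
      (∃ A ∈ V, ∃ B ∈ V, A * B - B * A ∉ V) := by
  have hP : 2 * (Nat.sqrt n * b) ≤ c * (Nat.sqrt n * b) := Nat.mul_le_mul_right _ hc
  exact ⟨finrank_gt_of_expensive V n _ hexp, choose_two_gt_of_expensive V hnil n _ hexp,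
    fun H hH hbud => exists_pow_ne_zero_of_expensive V n _ hexp hH hbud,
    exists_rank_gt_sqrt_of_expensive V n c hexp,
    exists_word_ne_zero_of_expensive_two V n _ hV hP hexp, exists_trace_word_ne_zero_of_expensive_two V n _ hV hP hexp,
    not_lieClosed_of_expensive_two V hnil n _ hV hP hexp⟩

end Summit.ValiantsHypothesis.ValiantsHypothesis.Theorems.GrenetZeon.NilSpaceViolatorPortrait

end
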